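import Literature.AlgebraicGeometry.GroupSchemes.CartierDualAnnihilatorRank
import Mathlib.AlgebraicGeometry.Morphisms.Flat
import HarnessLib

/-!
# Faithful flatness of homomorphisms of finite group schemes over a field: `Γ(f)` injective ⟺ `f` flat + surjective,
# and the kernel–rank law `rk G₁ = rk (Ker f) · rk G₂` for flat surjective `f`

Layer `Literature/AlgebraicGeometry/GroupSchemes`, namespace `Literature.AlgebraicGeometry.GroupSchemes.AffineGroupScheme` (continues ★
`CartierDualAnnihilatorRank` p845797 §1 — `finrank_alg_ker_mul_finrank : rk Γ(Ker φ) · rk Γ(G₂) = rk Γ(G₁)` for `Γ(φ)` injective —, ★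
`GroupSchemeKernelAlg` p845691 — `Γ(Ker φ) ≅ Γ(G₁) ⧸ φ^*(Γ(G₂)⁺)·Γ(G₁)` — and ★ `RingTheory/HopfAlgebra/FreeOverSubbialgebra` p845589 — a
finite-dimensional commutative Hopf algebra over a field is FREE over a sub-bialgebra, `faithfullyFlat_of_injective`).  THEOREMS ONLY; no definition, no instance, no notation,
no named fact, no `sorry`.  Cell `hodgecm-mathlib` (D-0151), programme P6 «MOD», organ (KR) = the byte «an fppf-surjective
homomorphism of finite `k`-group schemes is FLAT ⇒ rank of source = rank of kernel · rank of target» named by B-p08 (g31) 17:03:17Z (B)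
for F0P6b-plan (g2)՚s `Lines/F0_P6b_BlockNumerics.lean` `stub_N0_finrank_uniformizerKernel` (and ST-0 ∕ (a-rk) bookkeeping);
A-p17 (g25).  Count-neutral Mathlib-side capital: HC_CM is proved only modulo the 7 printed citations until rung 0 closes; nothing here
bears on it.

THE PRINT.  [Waterhouse1979] §14.1 Theorem (a commutative Hopf algebra is faithfully flat over a Hopf subalgebra; equivalently a
homomorphism of affine group schemes `G₁ → G₂` with `Γ(G₂) → Γ(G₁)` injective is faithfully flat) and its finite-case bookkeeping
«`ord G₁ = ord (Ker f) · ord G₂`» ([Montgomery1993Hopf] Cor. 3.2.1 Lagrange; [Tate1997FiniteFlatGroupSchemes] §(3.7)–(3.8)).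

DATA: `k` a field; `f : G₁ ⟶ G₂` a homomorphism (`IsMonHom`) of AFFINE group objects of `SchemeOver k` (no commutativity needed —
`Γ(G)` is a commutative Hopf algebra for every affine group scheme `G`, ★ `Alg.instHopfAlgebra`); finiteness enters as
`[Module.Finite k (Alg G₁)]` (e.g. from `IsFinite G₁.hom`, ★ `Alg.moduleFinite`).
* §1 (any base ring `R`, `G₁ G₂` affine) `specMap_appTop_eq` (`Spec Γ(f) = isoSpec⁻¹ ≫ f ≫ isoSpec`) and
  **`comap_injective_of_flat_of_surjective` — `[Flat f.left] [Surjective f.left] ⟹ Γ(f)` injective** (faithfully flat ring maps are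
  injective; Mathlib `RingHom.FaithfullyFlat.iff_flat_and_comap_surjective ∕ .injective`, flatness through `HasRingHomProperty.iff_of_isAffine`).
* §2 (field `k`; the rank identity itself for `Γ(f)` injective is ★ `finrank_alg_ker_mul_finrank` of `CartierDualAnnihilatorRank` p845797 —
  cited, not restated): `finrank_alg_ker_dvd_of_comap_injective` (`rk Ker f ∣ rk G₁`); **`faithfullyFlat_appTop_of_comap_injective` — `Γ(f)` is
  FAITHFULLY FLAT** (★ `FreeOverSubbialgebra.faithfullyFlat_of_injective`), hence **`flat_left_of_comap_injective : Flat f.left`** and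
  **`surjective_left_of_comap_injective : Surjective f.left`** (Waterhouse 14.1, finite case, in scheme clothing),
  **`comap_injective_iff_flat_and_surjective`**; and the door P6b uses: **`finrank_alg_eq_finrank_alg_ker_mul_of_flat_of_surjective` —
  `[Flat f.left] [Surjective f.left] ⟹ finrank k (Alg G₁) = finrank k (Alg (ker f)) * finrank k (Alg G₂)`**, `finrank_alg_dvd_of_flat_of_surjective`.

## References
* [Waterhouse1979] W. C. Waterhouse, *Introduction to Affine Group Schemes*, GTM 66 (1979), §14.1 (faithful flatness), §2.1 (kernels).
* [Montgomery1993Hopf] S. Montgomery, *Hopf algebras and their actions on rings*, CBMS 82 (1993), Cor. 3.2.1 (p. 30).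
* [GortzWedhorn2020] U. Görtz, T. Wedhorn, *Algebraic Geometry I*, 2nd ed. (2020), Definition 4.45 (2), p. 117 (kernels).
-/

set_option autoImplicit false

-- Mathlib's `Over`/`Scheme` APIs are stated across semireducible wrappers (as in the ★ `GroupSchemes/*` files).
set_option backward.isDefEq.respectTransparency false

universe u

open CategoryTheory CategoryTheory.Limits AlgebraicGeometry MonoidalCategory CartesianMonoidalCategory

noncomputable section

namespace Literature.AlgebraicGeometry.GroupSchemes

namespace AffineGroupScheme

open scoped MonObj

open Literature.AlgebraicGeometry.Motives Literature.NumberTheory.DiophantineGeometry Literature.RingTheory.HopfAlgebra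
  GroupSchemeKernel

/-! ## §1 Faithfully flat affine morphisms pull back functions injectively -/

section Injective

variable {R : Type u} [CommRing R] {G₁ G₂ : SchemeOver R} [IsAffine G₁.left] [IsAffine G₂.left] (f : G₁ ⟶ G₂)

/-- For affine `G₁ G₂`, `Spec Γ(f) = (G₁ ≅ Spec Γ(G₁))⁻¹ ≫ f ≫ (G₂ ≅ Spec Γ(G₂))` (Mathlib `Scheme.isoSpec_inv_naturality`).
[cite: GortzWedhorn2020, Definition 4.45 (2), p. 117] -/
theorem specMap_appTop_eq : Spec.map f.left.appTop = G₁.left.isoSpec.inv ≫ f.left ≫ G₂.left.isoSpec.hom := by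
  rw [← Category.assoc, ← Scheme.isoSpec_inv_naturality, Category.assoc, Iso.inv_hom_id, Category.comp_id]

/-- **`Γ(f)` is injective when `f` is flat and surjective** (a faithfully flat ring map is injective; Mathlib
`RingHom.FaithfullyFlat.injective`, flatness read through `HasRingHomProperty`, surjectivity of `Spec Γ(f)` from that of `f`).
[cite: Waterhouse1979, §14.1 Theorem; GortzWedhorn2020, Definition 4.45 (2), p. 117] -/
theorem comap_injective_of_flat_of_surjective [Flat f.left] [Surjective f.left] : Function.Injective (Alg.comap f) := by
  have hflat : f.left.appTop.hom.Flat := (HasRingHomProperty.iff_of_isAffine (P := @Flat)).mp inferInstance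
  have h1 : Surjective (Spec.map f.left.appTop) := by
    rw [specMap_appTop_eq f]
    infer_instance
  have hsurj : Function.Surjective (PrimeSpectrum.comap f.left.appTop.hom) := fun p => by
    obtain ⟨x, hx⟩ := h1.surj p
    exact ⟨x, hx⟩
  exact (RingHom.FaithfullyFlat.iff_flat_and_comap_surjective.mpr ⟨hflat, hsurj⟩).injective

end Injective

/-! ## §2 Over a field: `Γ(f)` injective ⟹ `rk G₁ = rk (Ker f) · rk G₂`, `f` flat and surjective -/

section Field

variable {k : Type u} [Field k] {G₁ G₂ : SchemeOver k} [GrpObj G₁] [IsAffine G₁.left] [GrpObj G₂] [IsAffine G₂.left]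
  (f : G₁ ⟶ G₂) [IsMonHom f]

/-- **`rk (Ker f) ∣ rk G₁`** when `Γ(f)` is injective. [cite: Montgomery1993Hopf, Corollary 3.2.1 (p. 30); Waterhouse1979, §14.1 Theorem] -/
theorem finrank_alg_ker_dvd_of_comap_injective [Module.Finite k (Alg G₁)] (hinj : Function.Injective (Alg.comap f)) :
    Module.finrank k (Alg (ker f)) ∣ Module.finrank k (Alg G₁) :=
  Dvd.intro _ (finrank_alg_ker_mul_finrank f hinj)

/-- **`Γ(f)` is faithfully flat** when it is injective (`Γ(G₁)` finite-dimensional): ★ `FreeOverSubbialgebra.faithfullyFlat_of_injective`.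
[cite: Waterhouse1979, §14.1 Theorem] -/
theorem faithfullyFlat_appTop_of_comap_injective [Module.Finite k (Alg G₁)] (hinj : Function.Injective (Alg.comap f)) :
    f.left.appTop.hom.FaithfullyFlat := by
  have h := FreeOverSubbialgebra.faithfullyFlat_of_injective (Alg.comapBialgHom f) hinj
  exact h

/-- **`f` is FLAT** when `Γ(f)` is injective. [cite: Waterhouse1979, §14.1 Theorem] -/
theorem flat_left_of_comap_injective [Module.Finite k (Alg G₁)] (hinj : Function.Injective (Alg.comap f)) : Flat f.left :=
  (HasRingHomProperty.iff_of_isAffine (P := @Flat)).mpr (faithfullyFlat_appTop_of_comap_injective f hinj).flat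

/-- **`f` is SURJECTIVE** when `Γ(f)` is injective. [cite: Waterhouse1979, §14.1 Theorem] -/
theorem surjective_left_of_comap_injective [Module.Finite k (Alg G₁)] (hinj : Function.Injective (Alg.comap f)) :
    Surjective f.left := by
  have hs : Function.Surjective (PrimeSpectrum.comap f.left.appTop.hom) :=
    (RingHom.FaithfullyFlat.iff_flat_and_comap_surjective.mp (faithfullyFlat_appTop_of_comap_injective f hinj)).2
  have h1 : Surjective (Spec.map f.left.appTop) := ⟨fun p => by
    obtain ⟨x, hx⟩ := hs p
    exact ⟨x, hx⟩⟩
  have h2 : Surjective (G₁.left.isoSpec.hom ≫ Spec.map f.left.appTop ≫ G₂.left.isoSpec.inv) := inferInstance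
  rw [specMap_appTop_eq f, Category.assoc, Category.assoc, Iso.hom_inv_id, Category.comp_id, Iso.hom_inv_id_assoc] at h2
  exact h2

/-- **KERNEL–RANK MULTIPLICATIVITY for a FLAT SURJECTIVE homomorphism: `rk G₁ = rk (Ker f) · rk G₂`** (★ `finrank_alg_ker_mul_finrank`
through §1; the door named in F0P6b-plan (g2)'s cut of record 17:07:22Z for `stub_N0`). [cite: Waterhouse1979, §14.1 Theorem; Montgomery1993Hopf, Corollary 3.2.1 (p. 30)] -/
theorem finrank_alg_eq_finrank_alg_ker_mul_of_flat_of_surjective [Module.Finite k (Alg G₁)] [Flat f.left] [Surjective f.left] :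
    Module.finrank k (Alg G₁) = Module.finrank k (Alg (ker f)) * Module.finrank k (Alg G₂) :=
  (finrank_alg_ker_mul_finrank f (comap_injective_of_flat_of_surjective f)).symm

/-- **`rk G₂ ∣ rk G₁` and `rk (Ker f) ∣ rk G₁` for a flat surjective homomorphism.** [cite: Montgomery1993Hopf, Corollary 3.2.1 (p. 30); Waterhouse1979, §14.1 Theorem] -/
theorem finrank_alg_dvd_of_flat_of_surjective [Module.Finite k (Alg G₁)] [Flat f.left] [Surjective f.left] :
    Module.finrank k (Alg G₂) ∣ Module.finrank k (Alg G₁) ∧ Module.finrank k (Alg (ker f)) ∣ Module.finrank k (Alg G₁) :=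
  ⟨finrank_alg_dvd_of_injective_comap f (comap_injective_of_flat_of_surjective f),
    finrank_alg_ker_dvd_of_comap_injective f (comap_injective_of_flat_of_surjective f)⟩

/-- **`Γ(f)` injective ⟺ `f` flat and surjective** (finite group schemes over a field). [cite: Waterhouse1979, §14.1 Theorem] -/
theorem comap_injective_iff_flat_and_surjective [Module.Finite k (Alg G₁)] :
    Function.Injective (Alg.comap f) ↔ Flat f.left ∧ Surjective f.left :=
  ⟨fun h => ⟨flat_left_of_comap_injective f h, surjective_left_of_comap_injective f h⟩,
    fun ⟨_, _⟩ => comap_injective_of_flat_of_surjective f⟩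

end Field

end AffineGroupScheme

end Literature.AlgebraicGeometry.GroupSchemes

end
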